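import Summits.KontsevichZagierPeriods.KontsevichZagierPeriods.Theses.ScissorsAvatars
import Summits.KontsevichZagierPeriods.KontsevichZagierPeriods.Theorems.MzvKernelInKZ.Negative.ScalingDivision

/-!
# `MzvScissorsSector` (stmt-KontsevichZagierPeriods-4259, route ScissorsAvatars, crux rank 5) — birth skeleton

Crux (verbatim the route decl `…Theses.ScissorsAvatars.MzvScissorsSector`, the SECTOR NODE of the thesis):
for every weight `w` and every `c` in the subgroup `Span_w ⊆ KZ.FormalRep` generated by the Kontsevich
simplex representations `[mzvRep s]` of the admissible indices `s` of weight `w`,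
`KZ.eval c = 0 → c ∈ C12 := AddSubgroup.closure (domainAddRel ∪ integrandAddRel ∪ changeOfVariablesRel)`
(the Newton–Leibniz-free "scissors" sub-calculus, rules 1a, 1b, 2 of Kontsevich–Zagier 2001, §1.2).

Line `birth` = the decomposition the route header itself names for this node ("Believed via:
DestabilisedScissors ∧ (the NL-allowed sector: CoactionDevissage SectorAssembly ⇐ HoffmanSpan +
Zagier/Brown-type independence) — glue MzvSectorGlue"), typed here over existing declarations only and
with the NL-allowed sector opened up into its two halves (spanning INSIDE the calculus / independence of
VALUES), so that the three kinds of content of the crux sit in three separately attackable stubs: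

* `stub_sectorDestabilisation` — STRUCTURAL (the route's own lever, "Newton–Leibniz only changes
  dimension", restricted to the MZV sector): a `c ∈ Span_w` that is a KZ relation (derivable with all four
  rules, through any dimensions) already lies in `C12`. It is the route crux `DestabilisedScissors`
  (stmt-KontsevichZagierPeriods-4257, rank 3) specialised to the sector: `Span_w ⊆ closure (range (of :
  IntegralRep w → FormalRep))`, so proving item 4257 proves this stub (`stub_sectorDestabilisation_of_destabilisedScissors`
  below, sorry-free); the specialisation survives a refutation of 4257 by a non-mixed-Tate witness
  (e.g. a dimension-2 Legendre pair known only through Stokes). No transcendence content (hypothesis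
  `c ∈ KZ.relations`, not `eval c = 0`). Size L/XL.
* `stub_hoffmanNormalForm` — RULES ≡ MOTIVES ON THE SECTOR, homogeneous Hoffman form (no transcendence,
  no `C12`): every `c ∈ Span_w` has a positive multiple congruent MODULO `KZ.relations` (all four rules
  allowed) to a `ℤ`-combination `h` of Hoffman simplex representations `[mzvRep u]`, `u ∈ {2,3}^×`,
  `weight u = w`. Brown 2012, Thm 1.1 gives the real/motivic decomposition with rational coefficients of
  the same weight; the stub asks that the four moves realise it (regularised double shuffle as move
  chains: CoactionDevissage `HoffmanSpan` stmt-3166 is the inhomogeneous all-`s` form, LinRedNormalForm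
  `HoffmanSpanInKZ` stmt-15044 the word form; this is their weight-graded consequence on the closure, by
  `AddSubgroup.closure_induction`). First instances: `w ≤ 2` trivial (`h := c`), `w = 3`:
  `[ζ(2,1)-rep] − [ζ(3)-rep]` is ONE duality move (landed for word reps:
  `MzvKernelInKZ.Negative.duality_mem_changeOfVariablesRel`), `w = 4`: `3[ζ(4)] − 4[ζ(2,2)]`,
  `3[ζ(3,1)] − [ζ(2,2)]`, `3[ζ(2,1,1)] − 4[ζ(2,2)]` ∈ relations (double shuffle + duality in weight 4;
  cf. route items Zeta31Scissors/Zeta22Scissors, which ask the sharper `C12` version). Size XL (open).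
* `stub_hoffmanIndependence` — THE DECLARED TRANSCENDENCE INPUT, per weight, in the calculus' own
  terms: an `h` in the subgroup generated by the weight-`w` Hoffman simplex representations with
  `KZ.eval h = 0` is `0` in `FormalRep`; i.e. (by `KZ.mzvRep_value_holds` and the injectivity of
  `u ↦ [mzvRep u]`) the real Hoffman values `ζ(u)`, `u ∈ {2,3}^×` of weight `w`, are `ℤ`-(⟺ `ℚ`-)linearly
  independent — the weight-`w` slice of LinRedNormalForm `HoffmanIndependence` (stmt-15045) / of the
  hypothesis of CoactionDevissage `SectorAssembly` (stmt-3174); given Brown 2012 it is the weight-`w` case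
  of Zagier's dimension conjecture. Conjecture-strength, neither provable nor cheaply killable
  (no `ℚ`-relation among Hoffman MZVs is known or expected). Size: open-problem.

Composition (sorry-free): `MzvScissorsSector_of : <stub₁-sig> → <stub₂-sig> → <stub₃-sig> → MzvScissorsSector`.
Given `c ∈ Span_w` with `eval c = 0`: stub 2 gives `N > 0`, `h ∈ HoffSpan_w`, `N • c − h ∈ relations`;
soundness of the calculus (`KZ.relations_le_ker_eval_holds`, tree theorem) gives `eval h = 0`; stub 3
gives `h = 0`, so `N • c ∈ relations`; INTEGER DIVISION is a derived rule of the calculus (tree theorem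
`MzvKernelInKZ.Negative.mem_relations_of_nsmul_mem`, Theorems/MzvKernelInKZ/Negative/ScalingDivision.lean),
so `c ∈ relations`; stub 1 puts it in `C12`. `MzvScissorsSector_skeleton : MzvScissorsSector` feeds the
three stubs in.

Disproof used: none on file for this crux (`ledger crux ls stmt-KontsevichZagierPeriods-4259`: no
workfiles before this one; no `Theorems/MzvScissorsSector/Negative/*`). Checked against the landed
negative side of the sibling crux `MzvKernelInKZ` (Theorems/MzvKernelInKZ/Negative/Core.lean):
`not_withoutEval` (dropping `eval c = 0` is false, witness `[pt, 1]`) — honoured: stub 1 keeps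
`c ∈ KZ.relations` as hypothesis (and `[pt,1] ∉ relations` by soundness), stub 3 keeps `eval h = 0`;
`withoutClosure_iff_summit` (dropping the restriction to the MZV closure IS the summit) — honoured: every
stub is restricted to `Span_w` / `HoffSpan_w`. `ledger negatives --problem KontsevichZagierPeriods`: one
entry (KinematicFormulas.KinematicPlaneConvex), unrelated.
-/

set_option linter.dupNamespace false

namespace Summit.KontsevichZagierPeriods.KontsevichZagierPeriods.Cruxes.MzvScissorsSector.Birth

open Summit.KontsevichZagierPeriods.KontsevichZagierPeriods.Theses.ScissorsAvatars (MzvScissorsSector DestabilisedScissors)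

/-! ## Stubs -/

/-- Stub 1 (SECTOR DESTABILISATION — "Newton–Leibniz only changes dimension" on the homogeneous MZV
sector): for `c` in the subgroup generated by the weight-`w` Kontsevich simplex representations,
`c ∈ KZ.relations → c ∈ C12 := closure (domainAddRel ∪ integrandAddRel ∪ changeOfVariablesRel)`. The route
crux `DestabilisedScissors` (stmt-KontsevichZagierPeriods-4257) restricted to `Span_w ⊆ closure (range of_w)`.
Why it might fail: an MZV relation whose only move chains leave dimension `w` (regularised double
shuffle is the only known engine beyond weight 6). Sources: KontsevichZagier2001 §1.2,
BrownCarrSchneps2010 (arXiv:0910.0122) §§1–2, CressonViusos2022, route item stmt-KontsevichZagierPeriods-4257. -/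
theorem stub_sectorDestabilisation : ∀ (w : ℕ) (c : Literature.NumberTheory.Transcendental.KZ.FormalRep), c ∈ AddSubgroup.closure {x : Literature.NumberTheory.Transcendental.KZ.FormalRep | ∃ (s : List ℕ) (hs : Literature.NumberTheory.Transcendental.MZV.IsAdmissible s), Literature.NumberTheory.Transcendental.MZV.weight s = w ∧ x = Literature.NumberTheory.Transcendental.KZ.of (Literature.NumberTheory.Transcendental.KZ.mzvRep s hs (Literature.NumberTheory.Transcendental.KZ.mzvIntegrand_isSemialgebraicFunOn_holds s) (Literature.NumberTheory.Transcendental.KZ.mzvIntegrand_integrableOn_holds s hs))} → c ∈ Literature.NumberTheory.Transcendental.KZ.relations → c ∈ AddSubgroup.closure (Literature.NumberTheory.Transcendental.KZ.domainAddRel ∪ Literature.NumberTheory.Transcendental.KZ.integrandAddRel ∪ Literature.NumberTheory.Transcendental.KZ.changeOfVariablesRel) := by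
  sorry

/-- Stub 2 (HOFFMAN NORMAL FORM INSIDE THE CALCULUS, homogeneous): every `c ∈ Span_w` has `N > 0` and an
`h` in the subgroup generated by the Hoffman simplex representations `[mzvRep u]` (`u ∈ {2,3}^×`,
`weight u = w`) with `N • c − h ∈ KZ.relations` (all four rules). "Rules ≡ motives" on the sector:
Brown 2012 Thm 1.1 supplies the decomposition with rational coefficients in the same weight, the stub
asks that the moves realise it. Weight-graded closure form of CoactionDevissage `HoffmanSpan` (stmt-3166)
/ LinRedNormalForm `HoffmanSpanInKZ` (stmt-15044). Why it might fail: regularised double-shuffle /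
associator relations may admit no move chain with absolutely convergent intermediates
(HuberMullerStach2017 Rem 13.1.8). Sources: Brown2012, arXiv:1102.1310, IharaKanekoZagier2006,
Souderes2010 (arXiv:0808.0248), Hoffman1997. -/
theorem stub_hoffmanNormalForm : ∀ (w : ℕ) (c : Literature.NumberTheory.Transcendental.KZ.FormalRep), c ∈ AddSubgroup.closure {x : Literature.NumberTheory.Transcendental.KZ.FormalRep | ∃ (s : List ℕ) (hs : Literature.NumberTheory.Transcendental.MZV.IsAdmissible s), Literature.NumberTheory.Transcendental.MZV.weight s = w ∧ x = Literature.NumberTheory.Transcendental.KZ.of (Literature.NumberTheory.Transcendental.KZ.mzvRep s hs (Literature.NumberTheory.Transcendental.KZ.mzvIntegrand_isSemialgebraicFunOn_holds s) (Literature.NumberTheory.Transcendental.KZ.mzvIntegrand_integrableOn_holds s hs))} → ∃ (N : ℕ) (h : Literature.NumberTheory.Transcendental.KZ.FormalRep), 0 < N ∧ h ∈ AddSubgroup.closure {x : Literature.NumberTheory.Transcendental.KZ.FormalRep | ∃ (s : List ℕ) (hs : Literature.NumberTheory.Transcendental.MZV.IsAdmissible s), Literature.NumberTheory.Transcendental.MZV.IsHoffman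 s ∧ Literature.NumberTheory.Transcendental.MZV.weight s = w ∧ x = Literature.NumberTheory.Transcendental.KZ.of (Literature.NumberTheory.Transcendental.KZ.mzvRep s hs (Literature.NumberTheory.Transcendental.KZ.mzvIntegrand_isSemialgebraicFunOn_holds s) (Literature.NumberTheory.Transcendental.KZ.mzvIntegrand_integrableOn_holds s hs))} ∧ N • c - h ∈ Literature.NumberTheory.Transcendental.KZ.relations := by
  sorry

/-- Stub 3 (HOFFMAN INDEPENDENCE, per weight, in `FormalRep` terms — the declared transcendence input):
an `h` in the subgroup generated by the weight-`w` Hoffman simplex representations with `KZ.eval h = 0`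
is `0`; equivalently (`KZ.mzvRep_value_holds`, injectivity of `u ↦ [mzvRep u]`) the real Hoffman values
of weight `w` are `ℤ`-linearly independent — the weight-`w` slice of LinRedNormalForm
`HoffmanIndependence` (stmt-15045); with Brown 2012 the weight-`w` case of Zagier's conjecture. Why it
might fail: fails iff ONE `ℚ`-linear relation among real Hoffman MZVs of one weight exists (none known
or expected; unreachable by present transcendence methods). Sources: Zagier1994 §9, Brown2012,
Hoffman1997, GoncharovECM2001 Conj. 1.1. -/
theorem stub_hoffmanIndependence : ∀ (w : ℕ) (h : Literature.NumberTheory.Transcendental.KZ.FormalRep), h ∈ AddSubgroup.closure {x : Literature.NumberTheory.Transcendental.KZ.FormalRep | ∃ (s : List ℕ) (hs : Literature.NumberTheory.Transcendental.MZV.IsAdmissible s), Literature.NumberTheory.Transcendental.MZV.IsHoffman s ∧ Literature.NumberTheory.Transcendental.MZV.weight s = w ∧ x = Literature.NumberTheory.Transcendental.KZ.of (Literature.NumberTheory.Transcendental.KZ.mzvRep s hs (Literature.NumberTheory.Transcendental.KZ.mzvIntegrand_isSemialgebraicFunOn_holds s) (Literature.NumberTheory.Transcendental.KZ.mzvIntegrand_integrableOn_holds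 s hs))} → Literature.NumberTheory.Transcendental.KZ.eval h = 0 → h = 0 := by
  sorry

/-! ## The composition (sorry-free) -/

/-- **Skeleton theorem, arrow form** (concludes the crux BY NAME): sector destabilisation → Hoffman
normal form in the calculus → Hoffman independence → `MzvScissorsSector`. Pure algebra: soundness
(`KZ.relations_le_ker_eval_holds`) transports `eval = 0` to the Hoffman normal form, independence kills
it, integer division (`MzvKernelInKZ.Negative.mem_relations_of_nsmul_mem`) removes `N`, destabilisation
lands in `C12`. [folklore] -/
theorem MzvScissorsSector_of :
    (∀ (w : ℕ) (c : Literature.NumberTheory.Transcendental.KZ.FormalRep), c ∈ AddSubgroup.closure {x : Literature.NumberTheory.Transcendental.KZ.FormalRep | ∃ (s : List ℕ) (hs : Literature.NumberTheory.Transcendental.MZV.IsAdmissible s), Literature.NumberTheory.Transcendental.MZV.weight s = w ∧ x = Literature.NumberTheory.Transcendental.KZ.of (Literature.NumberTheory.Transcendental.KZ.mzvRep s hs (Literature.NumberTheory.Transcendental.KZ.mzvIntegrand_isSemialgebraicFunOn_holds s) (Literature.NumberTheory.Transcendental.KZ.mzvIntegrand_integrableOn_holds s hs))} → c ∈ Literature.NumberTheory.Transcendental.KZ.relations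 → c ∈ AddSubgroup.closure (Literature.NumberTheory.Transcendental.KZ.domainAddRel ∪ Literature.NumberTheory.Transcendental.KZ.integrandAddRel ∪ Literature.NumberTheory.Transcendental.KZ.changeOfVariablesRel)) →
    (∀ (w : ℕ) (c : Literature.NumberTheory.Transcendental.KZ.FormalRep), c ∈ AddSubgroup.closure {x : Literature.NumberTheory.Transcendental.KZ.FormalRep | ∃ (s : List ℕ) (hs : Literature.NumberTheory.Transcendental.MZV.IsAdmissible s), Literature.NumberTheory.Transcendental.MZV.weight s = w ∧ x = Literature.NumberTheory.Transcendental.KZ.of (Literature.NumberTheory.Transcendental.KZ.mzvRep s hs (Literature.NumberTheory.Transcendental.KZ.mzvIntegrand_isSemialgebraicFunOn_holds s) (Literature.NumberTheory.Transcendental.KZ.mzvIntegrand_integrableOn_holds s hs))} → ∃ (N : ℕ) (h : Literature.NumberTheory.Transcendental.KZ.FormalRep), 0 < N ∧ h ∈ AddSubgroup.closure {x : Literature.NumberTheory.Transcendental.KZ.FormalRep | ∃ (s : List ℕ) (hs : Literature.NumberTheory.Transcendental.MZV.IsAdmissible s), Literature.NumberTheory.Transcendental.MZV.IsHoffman s ∧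 Literature.NumberTheory.Transcendental.MZV.weight s = w ∧ x = Literature.NumberTheory.Transcendental.KZ.of (Literature.NumberTheory.Transcendental.KZ.mzvRep s hs (Literature.NumberTheory.Transcendental.KZ.mzvIntegrand_isSemialgebraicFunOn_holds s) (Literature.NumberTheory.Transcendental.KZ.mzvIntegrand_integrableOn_holds s hs))} ∧ N • c - h ∈ Literature.NumberTheory.Transcendental.KZ.relations) →
    (∀ (w : ℕ) (h : Literature.NumberTheory.Transcendental.KZ.FormalRep), h ∈ AddSubgroup.closure {x : Literature.NumberTheory.Transcendental.KZ.FormalRep | ∃ (s : List ℕ) (hs : Literature.NumberTheory.Transcendental.MZV.IsAdmissible s), Literature.NumberTheory.Transcendental.MZV.IsHoffman s ∧ Literature.NumberTheory.Transcendental.MZV.weight s = w ∧ x = Literature.NumberTheory.Transcendental.KZ.of (Literature.NumberTheory.Transcendental.KZ.mzvRep s hs (Literature.NumberTheory.Transcendental.KZ.mzvIntegrand_isSemialgebraicFunOn_holds s) (Literature.NumberTheory.Transcendental.KZ.mzvIntegrand_integrableOn_holds s hs))} → Literature.NumberTheory.Transcendental.KZ.eval h = 0 → h = 0) →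
    MzvScissorsSector := by
  intro hD hN hI w c hc hc0
  obtain ⟨N, h, hNpos, hh, hrel⟩ := hN w c hc
  have hker : Literature.NumberTheory.Transcendental.KZ.eval (N • c - h) = 0 :=
    AddMonoidHom.mem_ker.1 (Literature.NumberTheory.Transcendental.KZ.relations_le_ker_eval_holds hrel)
  have hh0 : Literature.NumberTheory.Transcendental.KZ.eval h = 0 := by
    rw [map_sub, map_nsmul, hc0, smul_zero, zero_sub, neg_eq_zero] at hker
    exact hker
  have h0 : h = 0 := hI w h hh hh0
  rw [h0, sub_zero] at hrel
  exact hD w c hc (Summit.KontsevichZagierPeriods.MzvKernelInKZ.Negative.mem_relations_of_nsmul_mem hNpos hrel)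

/-- **Skeleton theorem, by name**: `MzvScissorsSector` from the three declared stubs. -/
theorem MzvScissorsSector_skeleton : MzvScissorsSector :=
  MzvScissorsSector_of stub_sectorDestabilisation stub_hoffmanNormalForm stub_hoffmanIndependence

/-! ## Ties to the route's items (sorry-free) -/

/-- Stub 1 is the route crux `DestabilisedScissors` (stmt-KontsevichZagierPeriods-4257) restricted to the
sector: the weight-`w` simplex representations are representations of dimension `w`. [folklore] -/
theorem stub_sectorDestabilisation_of_destabilisedScissors (hDS : DestabilisedScissors) :
    ∀ (w : ℕ) (c : Literature.NumberTheory.Transcendental.KZ.FormalRep), c ∈ AddSubgroup.closure {x : Literature.NumberTheory.Transcendental.KZ.FormalRep | ∃ (s : List ℕ) (hs : Literature.NumberTheory.Transcendental.MZV.IsAdmissible s), Literature.NumberTheory.Transcendental.MZV.weight s = w ∧ x = Literature.NumberTheory.Transcendental.KZ.of (Literature.NumberTheory.Transcendental.KZ.mzvRep s hs (Literature.NumberTheory.Transcendental.KZ.mzvIntegrand_isSemialgebraicFunOn_holds s) (Literature.NumberTheory.Transcendental.KZ.mzvIntegrand_integrableOn_holds s hs))} → c ∈ Literature.NumberTheory.Transcendental.KZ.relations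 → c ∈ AddSubgroup.closure (Literature.NumberTheory.Transcendental.KZ.domainAddRel ∪ Literature.NumberTheory.Transcendental.KZ.integrandAddRel ∪ Literature.NumberTheory.Transcendental.KZ.changeOfVariablesRel) := by
  intro w c hc hrel
  refine hDS w c (AddSubgroup.closure_mono ?_ hc) hrel
  rintro x ⟨s, hs, hw, rfl⟩
  subst hw
  exact ⟨_, rfl⟩

/-- Read-back: `DestabilisedScissors` is literally the dimension-wise statement used above. [folklore] -/
example : DestabilisedScissors ↔ (∀ (n : ℕ) (c : Literature.NumberTheory.Transcendental.KZ.FormalRep), c ∈ AddSubgroup.closure (Set.range (fun r : Literature.NumberTheory.Transcendental.KZ.IntegralRep n => Literature.NumberTheory.Transcendental.KZ.of r)) → c ∈ Literature.NumberTheory.Transcendental.KZ.relations → c ∈ AddSubgroup.closure (Literature.NumberTheory.Transcendental.KZ.domainAddRel ∪ Literature.NumberTheory.Transcendental.KZ.integrandAddRel ∪ Literature.NumberTheory.Transcendental.KZ.changeOfVariablesRel)) := Iff.rfl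

end Summit.KontsevichZagierPeriods.KontsevichZagierPeriods.Cruxes.MzvScissorsSector.Birth
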